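import Summits.Ventures.CertifiedManyBodySolver.Observables.SourcedRowsTIChordFloors
import Summits.Ventures.CertifiedManyBodySolver.Observables.PinningFieldMenuReaders
import Summits.Ventures.CertifiedManyBodySolver.Observables.TISourcedMinimiserChordFloorExact
import HarnessLib

/-!
# DOWNWARD field transport through the two-sided response node — THERMODYNAMIC-LIMIT forms: transported caps on
# `e_src(tp,U,μ,·)` from a response ceiling at the larger field, and the chord floors they give at the SMALLER field
# on infinite-volume ground states, torus-limit ground states, the stair, and cq-p2's canonical fixed-density class

HONEST FRAMING: finite-field RESPONSE floors/ceilings (certified once the input rows are); never an order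
parameter, never a phase word, no `h → 0` content; not a superconductivity verdict; every number certified or
labelled float. Nothing in this file is a number: soundness edges and slot arithmetic only; zero compute.

Cell hubbard-cq (LADDER rung CQ, row PC-a; D-0082 (c)), seat hubbard-cq-obsth-3, row «Hellmann–Feynman bracket →
m_d(h) two-sided node». Sequel of `PinningFieldCapTransportDown.lean` (the finite-torus / row layer and the REACH LAW:
a cap `hi₂` and a response ceiling `M₂` at ONE field `h₂` give the cap `hi₂ + 2(h₂ − h)M₂` at every `h ≤ h₂`, hence
chord floors on `(h₂ − (lo − hi₂)/(2M₂), h₂]`). Here the same tangent-line lever (Griffiths: a concave function lies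
below its tangents; Koma–Tasaki's sandwich read at the larger field) is stated for the thermodynamic-limit objects the
cell's leaves are phrased in:

* §4 grand-canonical class at `(μ, h)`: `e_src(h) ≤ e_src(h₂) + 2(h₂ − h)·M` for `h ≤ h₂` from the response bound
  `Re ω₂(P₀^d) ≤ M` of ONE translation-invariant mean-energy minimiser `ω₂` at `h₂` (weakest input;
  `…_of_isMeanEnergyMinimiser`), from a STAIR ceiling `liminf_L m_{L+1}(h₂) ≤ M` (`…_of_liminf_le`, the unconditional
  stair bracket `slope_energyDensity_le_liminf_dWaveSourceDensityTT'` read downward), or fully ROW/LEAF-fed from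
  `SourcedEnergyUpperRow … h₂ q L₀ hi` + `PinFieldResponseCeilingAt … h₂ q' L₀' M` (hubbard-obs-pin-1's
  `PinFieldResponseCeilingAt.liminf_le`: a ceiling leaf on ANY progression caps the all-sides stair); then, with a floor
  `c ≤ e_src(h₁)` at `h₁ < h` (a TL/GC lower, a `SourcedEnergyLowerRow`, or a tangent `μ`-floor), the FLOOR
  `(c − u − 2(h₂ − h)M)/(2(h − h₁)) ≤ Re ω(P₀^d)` for every infinite-volume ground state `ω` at `(μ, h)`
  (`responseFloor_isMeanEnergyMinimiser_of_transportDown[']`), every torus-limit ground state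
  (`…_torusLimit_…`, via `IsTorusLimitOf.isMeanEnergyMinimiser_sourced`), and the stair `liminf_L m_{L+1}(h)`
  (`responseFloor_liminf_of_transportDown`); rational-slot forms `m·2(h − h₁) + 2(h₂ − h)M ≤ lo − hi`
  (`SourcedEnergyLowerRow.responseFloor_{isMeanEnergyMinimiser,liminf,torusLimit}_of_capCeiling_of_slot`).
* §5 CANONICAL class at fixed density `n` (cq-p2's `TISourcedMinimiserChordFloorExact`): the canonical `h₂`-minimiser
  (`exists_minimiser_canonicalClass`) read at field `h` is the `hcap` witness at the smaller field with cap
  `u + 2(h₂ − h)M` (`exists_canonicalClass_sourced_le_transportDown`), given the cap `∃ σ, E_{h₂}(σ) ≤ u` and a one-point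
  ceiling `M` certified over the ENERGY-CAPPED canonical class at `h₂` (every translation-invariant `σ` of density `n`
  with `E_{h₂}(σ) ≤ u` has `Re σ(P₀^d) ≤ M` — what a MAX program with filling rows and an energy row certifies; it
  contains the minimisers); hence `re_expect_localPairAt_ge_of_minimiser_transportDown`:
  `(lo − (u + 2(h₂ − h)M))/(2h) ≤ Re ω(P₀^d)` for every exact canonical minimiser at `h ∈ (0, h₂]`, `lo ≤ e(1,tp,U,n)`
  (`#473` / `#504` BY NAME at the anchors).

WHY THE CLASS OF THE CEILING MATTERS (the reach law in one sentence, numbers in the prequel's docstring): a ceiling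
certified over an energy-capped class that CONTAINS the cap's own trial state is at least that state's response, and
then the transported floor is weaker than evaluating the trial state at `h` directly; the lever pays only with a
ceiling on the `h₂`-GROUND STATES that the cap states do not obey (minimiser-only rows: stationarity / KKT), or with a
ceiling at a field where no direct cap exists.

No definition, no named fact, no `sorry`.

References: T. Koma, H. Tasaki, J. Stat. Phys. 76 (1994) 745, §1 [cite: KomaTasaki1994, §1]; R. B. Griffiths,
Phys. Rev. 152 (1966) 240, §II [cite: Griffiths1966, §II]; O. Bratteli, A. Kishimoto, D. W. Robinson, CMP 64 (1978)
41, Thm. 2 [cite: BratteliKishimotoRobinson1978, Thm. 2].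
-/

noncomputable section

namespace Summit.Ventures.CertifiedManyBodySolver

open Literature.MathematicalPhysics.QuantumLattice Literature.MathematicalPhysics.QuantumLattice.ThermodynamicLimit
open Literature.Probability.LatticeModels HubbardWave0 InfVolFermionState _root_.Filter _root_.Matrix
open Summit.Ventures.CertifiedManyBodySolver.Observables
open scoped _root_.Topology

/-! ## §4  Thermodynamic limit, grand-canonical class at `(μ, h)`: transported caps on `e_src` and the floors
they give on infinite-volume ground states, torus-limit ground states and the stair -/

section TL

variable {tp U μ : ℝ} {ω : InfVolFermionState 2}

/-- **Field shift of the sourced mean energy (affine in `h`)**: for every infinite-volume state `ω`,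
`E^{μ}_h(ω) = E^{μ}_{h₂}(ω) + 2(h₂ − h)·Re ω(P₀^d)`. [cite: KomaTasaki1994, §1] -/
theorem meanEnergy_sourced_eq_add_field_shift (ω : InfVolFermionState 2) (tp U μ h h₂ : ℝ) :
    ω.meanEnergy (hubbardTTPrimeSourcedInteraction 1 tp U μ dWaveFormFactor h) 1 =
      ω.meanEnergy (hubbardTTPrimeSourcedInteraction 1 tp U μ dWaveFormFactor h₂) 1 +
        2 * (h₂ - h) * (ω.expect (pairRegion (insert (0 : Site 2) unitSteps) 0)
          (localPairAt (insert 0 unitSteps) dWaveFormFactor 0)).re := by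
  rw [meanEnergy_hubbardTTPrimeSourced, meanEnergy_hubbardTTPrimeSourced, meanEnergy_pairSourceInteraction_dWave_eq]
  ring

/-- **Transported cap on `e_src` from ONE `h₂`-ground state's response** (weakest ceiling input): if `ω₂` is a
translation-invariant mean-energy minimiser at `(μ, h₂)` with `Re ω₂(P₀^d) ≤ M`, then for every `h ≤ h₂`,
`e_src(h) ≤ e_src(h₂) + 2(h₂ − h)M` (`ω₂` is a trial state at `h`). [cite: Griffiths1966, §II]
[cite: BratteliKishimotoRobinson1978, Thm. 2] -/
theorem dWaveSourceEnergyDensityTT'_le_transportDown_of_isMeanEnergyMinimiser {ω₂ : InfVolFermionState 2}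
    {h h₂ : ℝ} (hle : h ≤ h₂)
    (hmin₂ : ω₂.IsMeanEnergyMinimiser (hubbardTTPrimeSourcedInteraction 1 tp U μ dWaveFormFactor h₂) 1) {M : ℝ}
    (hM : (ω₂.expect (pairRegion (insert (0 : Site 2) unitSteps) 0)
      (localPairAt (insert 0 unitSteps) dWaveFormFactor 0)).re ≤ M) :
    dWaveSourceEnergyDensityTT' tp U μ h ≤ dWaveSourceEnergyDensityTT' tp U μ h₂ + 2 * (h₂ - h) * M := by
  have h1 := dWaveSourceEnergyDensityTT'_le_meanEnergy_sourced tp U μ h hmin₂.1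
  rw [meanEnergy_sourced_eq_add_field_shift ω₂ tp U μ h h₂,
    meanEnergy_sourced_eq_dWaveSourceEnergyDensityTT'_of_isMeanEnergyMinimiser hmin₂] at h1
  have h2 := mul_le_mul_of_nonneg_left hM (by linarith : (0 : ℝ) ≤ 2 * (h₂ - h))
  linarith

/-- **Transported cap on `e_src` from a STAIR ceiling**: `liminf_L m_{L+1}(h₂) ≤ M` and `h ≤ h₂` give
`e_src(h) ≤ e_src(h₂) + 2(h₂ − h)M` (obsth-3's unconditional stair bracket
`slope_energyDensity_le_liminf_dWaveSourceDensityTT'` read downward). [cite: KomaTasaki1994, §1] -/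
theorem dWaveSourceEnergyDensityTT'_le_transportDown_of_liminf_le {h h₂ M : ℝ} (hle : h ≤ h₂)
    (hM : liminf (fun L : ℕ => dWaveSourceDensityTT' (L + 1) tp U μ h₂) atTop ≤ M) :
    dWaveSourceEnergyDensityTT' tp U μ h ≤ dWaveSourceEnergyDensityTT' tp U μ h₂ + 2 * (h₂ - h) * M := by
  rcases hle.eq_or_lt with rfl | hlt
  · simp
  have h1 := (slope_energyDensity_le_liminf_dWaveSourceDensityTT' tp U μ hlt).trans hM
  rw [div_le_iff₀ (by linarith)] at h1
  linarith

/-- **Transported cap on `e_src`, fully ROW/LEAF-fed**: a cap row `hi` at `h₂` (progression `q ≥ 1`), a ceiling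
leaf `M` at `h₂` (progression `q' ≥ 1`; it caps the all-sides stair, `PinFieldResponseCeilingAt.liminf_le`) and
`h ≤ h₂` give `e_src(h) ≤ hi + 2(h₂ − h)M`. [cite: KomaTasaki1994, §1] -/
theorem SourcedEnergyUpperRow.dWaveSourceEnergyDensityTT'_le_transportDown {q q' L₀ L₀' : ℕ} {h h₂ : ℝ}
    (hle : h ≤ h₂) {hi M : ℚ} (hhi : SourcedEnergyUpperRow tp U μ h₂ q L₀ hi) (hq : 0 < q)
    (hM : PinFieldResponseCeilingAt tp U μ h₂ q' L₀' M) (hq' : 0 < q') :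
    dWaveSourceEnergyDensityTT' tp U μ h ≤ ((hi : ℚ) : ℝ) + 2 * (h₂ - h) * ((M : ℚ) : ℝ) := by
  have h1 := dWaveSourceEnergyDensityTT'_le_transportDown_of_liminf_le (tp := tp) (U := U) (μ := μ) hle
    (hM.liminf_le hq')
  have h2 := hhi.dWaveSourceEnergyDensityTT'_le hq
  linarith

/-- **FLOOR on every infinite-volume ground state at the SMALLER field, TL-number form**: `c ≤ e_src(h₁)`, `h₁ < h ≤ h₂`,
`e_src(h₂) ≤ u`, a stair ceiling `liminf_L m_{L+1}(h₂) ≤ M`, and `ω` a translation-invariant mean-energy minimiser at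
`(μ, h)` give `(c − u − 2(h₂ − h)M)/(2(h − h₁)) ≤ Re ω(P₀^d)`. [cite: Griffiths1966, §II] [cite: KomaTasaki1994, §1] -/
theorem responseFloor_isMeanEnergyMinimiser_of_transportDown {h₁ h h₂ c u M : ℝ} (hlt : h₁ < h) (hle : h ≤ h₂)
    (hc : c ≤ dWaveSourceEnergyDensityTT' tp U μ h₁) (hu : dWaveSourceEnergyDensityTT' tp U μ h₂ ≤ u)
    (hM : liminf (fun L : ℕ => dWaveSourceDensityTT' (L + 1) tp U μ h₂) atTop ≤ M)
    (hmin : ω.IsMeanEnergyMinimiser (hubbardTTPrimeSourcedInteraction 1 tp U μ dWaveFormFactor h) 1) :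
    (c - u - 2 * (h₂ - h) * M) / (2 * (h - h₁)) ≤
      (ω.expect (pairRegion (insert (0 : Site 2) unitSteps) 0)
        (localPairAt (insert 0 unitSteps) dWaveFormFactor 0)).re := by
  have hcap := dWaveSourceEnergyDensityTT'_le_transportDown_of_liminf_le (tp := tp) (U := U) (μ := μ) hle hM
  have hω : ω.meanEnergy (hubbardTTPrimeSourcedInteraction 1 tp U μ dWaveFormFactor h) 1 ≤ u + 2 * (h₂ - h) * M := by
    rw [meanEnergy_sourced_eq_dWaveSourceEnergyDensityTT'_of_isMeanEnergyMinimiser hmin]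
    linarith
  have h1 := responseFloor_of_energyDensity_le_of_sourced_le hlt hc hmin.1 hω
  rwa [show c - (u + 2 * (h₂ - h) * M) = c - u - 2 * (h₂ - h) * M by ring] at h1

/-- **FLOOR on every infinite-volume ground state at the smaller field, ceiling fed by ONE `h₂`-ground state**
(the infinite-volume input form): `c ≤ e_src(h₁)`, `e_src(h₂) ≤ u`, a minimiser `ω₂` at `h₂` with `Re ω₂(P₀^d) ≤ M`.
[cite: Griffiths1966, §II] [cite: BratteliKishimotoRobinson1978, Thm. 2] -/
theorem responseFloor_isMeanEnergyMinimiser_of_transportDown' {ω₂ : InfVolFermionState 2} {h₁ h h₂ c u M : ℝ}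
    (hlt : h₁ < h) (hle : h ≤ h₂)
    (hc : c ≤ dWaveSourceEnergyDensityTT' tp U μ h₁) (hu : dWaveSourceEnergyDensityTT' tp U μ h₂ ≤ u)
    (hmin₂ : ω₂.IsMeanEnergyMinimiser (hubbardTTPrimeSourcedInteraction 1 tp U μ dWaveFormFactor h₂) 1)
    (hM : (ω₂.expect (pairRegion (insert (0 : Site 2) unitSteps) 0)
      (localPairAt (insert 0 unitSteps) dWaveFormFactor 0)).re ≤ M)
    (hmin : ω.IsMeanEnergyMinimiser (hubbardTTPrimeSourcedInteraction 1 tp U μ dWaveFormFactor h) 1) :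
    (c - u - 2 * (h₂ - h) * M) / (2 * (h - h₁)) ≤
      (ω.expect (pairRegion (insert (0 : Site 2) unitSteps) 0)
        (localPairAt (insert 0 unitSteps) dWaveFormFactor 0)).re := by
  have hcap := dWaveSourceEnergyDensityTT'_le_transportDown_of_isMeanEnergyMinimiser (tp := tp) (U := U) (μ := μ)
    hle hmin₂ hM
  have hω : ω.meanEnergy (hubbardTTPrimeSourcedInteraction 1 tp U μ dWaveFormFactor h) 1 ≤ u + 2 * (h₂ - h) * M := by
    rw [meanEnergy_sourced_eq_dWaveSourceEnergyDensityTT'_of_isMeanEnergyMinimiser hmin]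
    linarith
  have h1 := responseFloor_of_energyDensity_le_of_sourced_le hlt hc hmin.1 hω
  rwa [show c - (u + 2 * (h₂ - h) * M) = c - u - 2 * (h₂ - h) * M by ring] at h1

/-- **Stair FLOOR at the smaller field**: `c ≤ e_src(h₁)`, `e_src(h₂) ≤ u`, `liminf_L m_{L+1}(h₂) ≤ M`, `h₁ < h ≤ h₂`
give `(c − u − 2(h₂ − h)M)/(2(h − h₁)) ≤ liminf_L m_{L+1}(h)`. [cite: KomaTasaki1994, §1] -/
theorem responseFloor_liminf_of_transportDown {h₁ h h₂ c u M : ℝ} (hlt : h₁ < h) (hle : h ≤ h₂)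
    (hc : c ≤ dWaveSourceEnergyDensityTT' tp U μ h₁) (hu : dWaveSourceEnergyDensityTT' tp U μ h₂ ≤ u)
    (hM : liminf (fun L : ℕ => dWaveSourceDensityTT' (L + 1) tp U μ h₂) atTop ≤ M) :
    (c - u - 2 * (h₂ - h) * M) / (2 * (h - h₁)) ≤
      liminf (fun L : ℕ => dWaveSourceDensityTT' (L + 1) tp U μ h) atTop := by
  have hcap := dWaveSourceEnergyDensityTT'_le_transportDown_of_liminf_le (tp := tp) (U := U) (μ := μ) hle hM
  have h3 : (c - u - 2 * (h₂ - h) * M) / (2 * (h - h₁)) ≤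
      (dWaveSourceEnergyDensityTT' tp U μ h₁ - dWaveSourceEnergyDensityTT' tp U μ h) / (2 * (h - h₁)) :=
    div_le_div_of_nonneg_right (by linarith) (by linarith)
  exact h3.trans (slope_energyDensity_le_liminf_dWaveSourceDensityTT' tp U μ hlt)

/-- **FLOOR on every torus-limit ground state at the smaller field** (torus limits of ground-state vectors of
`A_L(tp,U,μ,h)` along divergent sides are mean-energy minimisers, `IsTorusLimitOf.isMeanEnergyMinimiser_sourced`).
[cite: KomaTasaki1994, §1] [cite: BratteliKishimotoRobinson1978, Thm. 2] -/
theorem responseFloor_torusLimit_of_transportDown {ψ : ∀ L, Fock (Orb (FermionTorus 2 L))} {Ls : ℕ → ℕ}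
    [hL0 : ∀ j, NeZero (Ls j)] (hω : ω.IsTorusLimitOf ψ Ls) (hLs : Tendsto Ls atTop atTop)
    (hψ : ∀ j, star (ψ (Ls j)) ⬝ᵥ ψ (Ls j) = 1) {h : ℝ}
    (hgs : ∀ j, dWaveSourceTorusTT' (Ls j) tp U μ h *ᵥ ψ (Ls j) =
      ((Matrix.groundEnergy (dWaveSourceTorusTT' (Ls j) tp U μ h) : ℝ) : ℂ) • ψ (Ls j))
    {h₁ h₂ c u M : ℝ} (hlt : h₁ < h) (hle : h ≤ h₂)
    (hc : c ≤ dWaveSourceEnergyDensityTT' tp U μ h₁) (hu : dWaveSourceEnergyDensityTT' tp U μ h₂ ≤ u)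
    (hM : liminf (fun L : ℕ => dWaveSourceDensityTT' (L + 1) tp U μ h₂) atTop ≤ M) :
    (c - u - 2 * (h₂ - h) * M) / (2 * (h - h₁)) ≤
      (ω.expect (pairRegion (insert (0 : Site 2) unitSteps) 0)
        (localPairAt (insert 0 unitSteps) dWaveFormFactor 0)).re :=
  responseFloor_isMeanEnergyMinimiser_of_transportDown hlt hle hc hu hM
    (hω.isMeanEnergyMinimiser_sourced hLs hψ tp U μ h hgs)

variable {q q' q'' L₀ L₀' L₀'' : ℕ} {lo hi M : ℚ}

/-- **Slot form, fully ROW/LEAF-fed, infinite-volume ground states**: floor row `lo` at `h₁ < h` (`q ≥ 1`), cap row `hi`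
at `h₂ ≥ h` (`q' ≥ 1`), ceiling leaf `M` at `h₂` (`q'' ≥ 1`) and a rational slot `m` with
`m·2(h − h₁) + 2(h₂ − h)M ≤ lo − hi` give `m ≤ Re ω(P₀^d)` for every translation-invariant mean-energy minimiser at
`(tp,U,μ,h)`. [cite: Griffiths1966, §II] [cite: BratteliKishimotoRobinson1978, Thm. 2] -/
theorem SourcedEnergyLowerRow.responseFloor_isMeanEnergyMinimiser_of_capCeiling_of_slot {h₁ h h₂ : ℝ}
    (hlt : h₁ < h) (hle : h ≤ h₂)
    (hlo : SourcedEnergyLowerRow tp U μ h₁ q L₀ lo) (hq : 0 < q)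
    (hhi : SourcedEnergyUpperRow tp U μ h₂ q' L₀' hi) (hq' : 0 < q')
    (hM : PinFieldResponseCeilingAt tp U μ h₂ q'' L₀'' M) (hq'' : 0 < q'') {m : ℚ}
    (hm : ((m : ℚ) : ℝ) * (2 * (h - h₁)) + 2 * (h₂ - h) * ((M : ℚ) : ℝ) ≤ ((lo : ℚ) : ℝ) - ((hi : ℚ) : ℝ))
    (hmin : ω.IsMeanEnergyMinimiser (hubbardTTPrimeSourcedInteraction 1 tp U μ dWaveFormFactor h) 1) :
    ((m : ℚ) : ℝ) ≤
      (ω.expect (pairRegion (insert (0 : Site 2) unitSteps) 0)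
        (localPairAt (insert 0 unitSteps) dWaveFormFactor 0)).re := by
  have h1 := responseFloor_isMeanEnergyMinimiser_of_transportDown hlt hle (hlo.le_dWaveSourceEnergyDensityTT' hq)
    (hhi.dWaveSourceEnergyDensityTT'_le hq') (hM.liminf_le hq'') hmin
  refine le_trans ?_ h1
  rw [le_div_iff₀ (by linarith)]
  linarith

/-- **Slot form, fully ROW/LEAF-fed, the stair**: `m ≤ liminf_L m_{L+1}(tp,U,μ;h)`. [cite: KomaTasaki1994, §1] -/
theorem SourcedEnergyLowerRow.responseFloor_liminf_of_capCeiling_of_slot {h₁ h h₂ : ℝ}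
    (hlt : h₁ < h) (hle : h ≤ h₂)
    (hlo : SourcedEnergyLowerRow tp U μ h₁ q L₀ lo) (hq : 0 < q)
    (hhi : SourcedEnergyUpperRow tp U μ h₂ q' L₀' hi) (hq' : 0 < q')
    (hM : PinFieldResponseCeilingAt tp U μ h₂ q'' L₀'' M) (hq'' : 0 < q'') {m : ℚ}
    (hm : ((m : ℚ) : ℝ) * (2 * (h - h₁)) + 2 * (h₂ - h) * ((M : ℚ) : ℝ) ≤ ((lo : ℚ) : ℝ) - ((hi : ℚ) : ℝ)) :
    ((m : ℚ) : ℝ) ≤ liminf (fun L : ℕ => dWaveSourceDensityTT' (L + 1) tp U μ h) atTop := by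
  have h1 := responseFloor_liminf_of_transportDown (tp := tp) (U := U) (μ := μ) hlt hle
    (hlo.le_dWaveSourceEnergyDensityTT' hq) (hhi.dWaveSourceEnergyDensityTT'_le hq') (hM.liminf_le hq'')
  refine le_trans ?_ h1
  rw [le_div_iff₀ (by linarith)]
  linarith

/-- **Slot form, fully ROW/LEAF-fed, torus-limit ground states.** [cite: KomaTasaki1994, §1] -/
theorem SourcedEnergyLowerRow.responseFloor_torusLimit_of_capCeiling_of_slot
    {ψ : ∀ L, Fock (Orb (FermionTorus 2 L))} {Ls : ℕ → ℕ} [hL0 : ∀ j, NeZero (Ls j)]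
    (hω : ω.IsTorusLimitOf ψ Ls) (hLs : Tendsto Ls atTop atTop) (hψ : ∀ j, star (ψ (Ls j)) ⬝ᵥ ψ (Ls j) = 1) {h : ℝ}
    (hgs : ∀ j, dWaveSourceTorusTT' (Ls j) tp U μ h *ᵥ ψ (Ls j) =
      ((Matrix.groundEnergy (dWaveSourceTorusTT' (Ls j) tp U μ h) : ℝ) : ℂ) • ψ (Ls j))
    {h₁ h₂ : ℝ} (hlt : h₁ < h) (hle : h ≤ h₂)
    (hlo : SourcedEnergyLowerRow tp U μ h₁ q L₀ lo) (hq : 0 < q)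
    (hhi : SourcedEnergyUpperRow tp U μ h₂ q' L₀' hi) (hq' : 0 < q')
    (hM : PinFieldResponseCeilingAt tp U μ h₂ q'' L₀'' M) (hq'' : 0 < q'') {m : ℚ}
    (hm : ((m : ℚ) : ℝ) * (2 * (h - h₁)) + 2 * (h₂ - h) * ((M : ℚ) : ℝ) ≤ ((lo : ℚ) : ℝ) - ((hi : ℚ) : ℝ)) :
    ((m : ℚ) : ℝ) ≤
      (ω.expect (pairRegion (insert (0 : Site 2) unitSteps) 0)
        (localPairAt (insert 0 unitSteps) dWaveFormFactor 0)).re :=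
  hlo.responseFloor_isMeanEnergyMinimiser_of_capCeiling_of_slot hlt hle hq hhi hq' hM hq'' hm
    (hω.isMeanEnergyMinimiser_sourced hLs hψ tp U μ h hgs)

end TL

/-! ## §5  Canonical class at fixed density `n` (cq-p2's exact-minimiser consumer): the transported cap witness and
the floor at the smaller field -/

section Canonical

variable {ω : InfVolFermionState 2} {tp U n h h₂ lo u M : ℝ}

/-- **Transported canonical cap witness.** If SOME translation-invariant state of density `n ∈ [0,2)` has sourced
energy `≤ u` at `h₂`, and every such state with sourced energy `≤ u` at `h₂` has `Re σ(P₀^d) ≤ M` (a one-point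
ceiling certified over the energy-capped canonical class at `h₂` — it contains the canonical `h₂`-minimisers), then
for every `h ≤ h₂` SOME translation-invariant state of density `n` has sourced energy `≤ u + 2(h₂ − h)M` at `h`:
the canonical minimiser at `h₂` (`exists_minimiser_canonicalClass`), read at field `h`. This is exactly the `hcap`
input of `re_expect_localPairAt_ge_of_minimiser` at the smaller field. [cite: Griffiths1966, §II]
[cite: BratteliKishimotoRobinson1978, Thm. 2] -/
theorem exists_canonicalClass_sourced_le_transportDown (hn0 : 0 ≤ n) (hn2 : n < 2) (hle : h ≤ h₂)
    (hcap : ∃ σ : InfVolFermionState 2, σ.IsTranslationInvariant ∧ σ.density = n ∧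
      σ.meanEnergy (hubbardTTPrimeSourcedInteraction 1 tp U 0 dWaveFormFactor h₂) 1 ≤ u)
    (hM : ∀ σ : InfVolFermionState 2, σ.IsTranslationInvariant → σ.density = n →
      σ.meanEnergy (hubbardTTPrimeSourcedInteraction 1 tp U 0 dWaveFormFactor h₂) 1 ≤ u →
        (σ.expect (pairRegion (insert (0 : Site 2) unitSteps) 0)
          (localPairAt (insert 0 unitSteps) dWaveFormFactor 0)).re ≤ M) :
    ∃ σ : InfVolFermionState 2, σ.IsTranslationInvariant ∧ σ.density = n ∧
      σ.meanEnergy (hubbardTTPrimeSourcedInteraction 1 tp U 0 dWaveFormFactor h) 1 ≤ u + 2 * (h₂ - h) * M := by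
  obtain ⟨ω₂, hω₂, hρ₂, hmin₂⟩ :=
    exists_minimiser_canonicalClass (n := n) (hubbardTTPrimeSourcedInteraction 1 tp U 0 dWaveFormFactor h₂) hn0 hn2
  obtain ⟨σ, hσ, hσn, hσu⟩ := hcap
  have hu₂ : ω₂.meanEnergy (hubbardTTPrimeSourcedInteraction 1 tp U 0 dWaveFormFactor h₂) 1 ≤ u :=
    (hmin₂ σ hσ hσn).trans hσu
  have hM₂ := hM ω₂ hω₂ hρ₂ hu₂
  refine ⟨ω₂, hω₂, hρ₂, ?_⟩
  rw [meanEnergy_sourced_eq_add_field_shift ω₂ tp U 0 h h₂]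
  have h2 := mul_le_mul_of_nonneg_left hM₂ (by linarith : (0 : ℝ) ≤ 2 * (h₂ - h))
  linarith

/-- **Canonical-class FLOOR at the smaller field** (every exact minimiser of `E_h` over translation-invariant states of
density `n ∈ (0,2)`; `U ≥ 0`): a TL canonical lower `lo ≤ e(1,tp,U,n)` (e.g. `#473` / `#504` BY NAME), the canonical
cap `hcap` at `h₂ ≥ h > 0` and the energy-capped one-point ceiling `hM` at `h₂` give
`(lo − (u + 2(h₂ − h)M))/(2h) ≤ Re ω(P₀^d)`. Teeth iff `h > h₂ − (lo − u)/(2M)` (§3). A large-field RESPONSE floor at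
the smaller field; never an order parameter. [cite: Griffiths1966, §II] [cite: KomaTasaki1994, §1] -/
theorem re_expect_localPairAt_ge_of_minimiser_transportDown (hω : ω.IsTranslationInvariant) (hU : 0 ≤ U)
    (hρ : ω.density = n) (hn0 : 0 < n) (hn2 : n < 2) (hh : 0 < h) (hle : h ≤ h₂)
    (hlo : lo ≤ energyDensityTT' 1 tp U n)
    (hmin : ∀ ω' : InfVolFermionState 2, ω'.IsTranslationInvariant → ω'.density = n →
      ω.meanEnergy (hubbardTTPrimeSourcedInteraction 1 tp U 0 dWaveFormFactor h) 1 ≤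
        ω'.meanEnergy (hubbardTTPrimeSourcedInteraction 1 tp U 0 dWaveFormFactor h) 1)
    (hcap : ∃ σ : InfVolFermionState 2, σ.IsTranslationInvariant ∧ σ.density = n ∧
      σ.meanEnergy (hubbardTTPrimeSourcedInteraction 1 tp U 0 dWaveFormFactor h₂) 1 ≤ u)
    (hM : ∀ σ : InfVolFermionState 2, σ.IsTranslationInvariant → σ.density = n →
      σ.meanEnergy (hubbardTTPrimeSourcedInteraction 1 tp U 0 dWaveFormFactor h₂) 1 ≤ u →
        (σ.expect (pairRegion (insert (0 : Site 2) unitSteps) 0)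
          (localPairAt (insert 0 unitSteps) dWaveFormFactor 0)).re ≤ M) :
    (lo - (u + 2 * (h₂ - h) * M)) / (2 * h) ≤
      (ω.expect (pairRegion (insert (0 : Site 2) unitSteps) 0)
        (localPairAt (insert 0 unitSteps) dWaveFormFactor 0)).re :=
  re_expect_localPairAt_ge_of_minimiser hω hU hρ hn0 hn2 hh hlo hmin
    (exists_canonicalClass_sourced_le_transportDown hn0.le hn2 hle hcap hM)

end Canonical

/-! ## §6  HONESTY of the lever against its own cap witness (appended 2026-08-27, hubbard-cq-obsth-3 g4): when the state
that certifies the cap at `h₂` lies in the class the ceiling is certified over, the transported cap is already that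
state's own energy at the smaller field — the lever pays only with a ceiling the cap witness does NOT obey
(minimiser-only rows) or at a field where no direct cap exists -/

section Honesty

variable {tp U μ : ℝ}

/-- **The cap witness certifies the transported cap by itself.** If a state `σ` has sourced energy `E^{μ}_{h₂}(σ) ≤ u`
and response `Re σ(P₀^d) ≤ M` (i.e. `σ` belongs to the energy-capped class the ceiling `M` is certified over), then at
every `h ≤ h₂` its OWN sourced energy is `≤ u + 2(h₂ − h)M`: evaluating `σ` at the smaller field is at least as good as
the transported cap. Hence a one-point ceiling certified over a class containing the cap's trial state never extends
reach beyond that trial state's affine energy line. [cite: KomaTasaki1994, §1] -/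
theorem meanEnergy_sourced_le_transportedCap (σ : InfVolFermionState 2) {h h₂ u M : ℝ} (hle : h ≤ h₂)
    (hσu : σ.meanEnergy (hubbardTTPrimeSourcedInteraction 1 tp U μ dWaveFormFactor h₂) 1 ≤ u)
    (hσM : (σ.expect (pairRegion (insert (0 : Site 2) unitSteps) 0)
      (localPairAt (insert 0 unitSteps) dWaveFormFactor 0)).re ≤ M) :
    σ.meanEnergy (hubbardTTPrimeSourcedInteraction 1 tp U μ dWaveFormFactor h) 1 ≤ u + 2 * (h₂ - h) * M := by
  rw [meanEnergy_sourced_eq_add_field_shift σ tp U μ h h₂]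
  have h2 := mul_le_mul_of_nonneg_left hσM (by linarith : (0 : ℝ) ≤ 2 * (h₂ - h))
  linarith

/-- **Reach is bounded by the cap witness's own response.** If the cap witness `σ` (energy `≤ u` at `h₂`, response
`m_σ`) lies in the ceiling's class, then `m_σ ≤ M`, so the transported slot with `M` is at most the slot with `m_σ`:
`lo − u − 2(h₂ − h)M ≤ lo − u − 2(h₂ − h)m_σ` for `h ≤ h₂` — the reach threshold `h₂ − (lo − u)/(2M)` is no smaller than
`h₂ − (lo − u)/(2m_σ)`. [folklore] -/
theorem transportedSlot_le_of_witness_le {h h₂ lo u M mσ : ℝ} (hle : h ≤ h₂) (hσM : mσ ≤ M) :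
    lo - u - 2 * (h₂ - h) * M ≤ lo - u - 2 * (h₂ - h) * mσ := by
  have h2 := mul_le_mul_of_nonneg_left hσM (by linarith : (0 : ℝ) ≤ 2 * (h₂ - h))
  linarith

end Honesty

end Summit.Ventures.CertifiedManyBodySolver

end
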